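import Summits.AnomalousDissipation.AnomalousDissipation.Theorems.MarginalStabilityChainStretchedVortexRowsStubBraidExitTools
import Summits.AnomalousDissipation.AnomalousDissipation.Theorems.MarginalStabilityChainStretchedVortexRowsStubBraidExitDomain

/-!
# Tools for the stub `stub_braidExit` (line `braid-closed-large-circulation-gluing`, crux
# stmt-AnomalousDissipation-3009), part C: the cell layer — `G(log D) + κ(L/π) sin a sinh b` is a global
# Lyapunov function of the strained vortex row, degenerate only at the saddles

Notation of parts A (`…StubBraidExitTools`) and B (`…StubBraidExitDomain`): `a = 2πx/L`, `b = 2πy/L`,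
`D = cosh b − cos a`, `E = cosh b + cos a`, `S = sin a sinh b`, `𝒜 = νΔ + U₀·∇` the stub's operator.
From the two exact identities `𝒜G(log D) = ν(2π/L)²(E/D)G″ − G′·b sinh b/D` (part A) and
`𝒜S = (π/L)[−E·D + E(cosh b − 1)(1 + cos a)]/D − b sin a cosh b` (part B) this file proves the
pointwise inequality of the CELL LAYER of the exit-time construction:

* `rowOperator_lyapunovLayer_le`: for `|b| ≤ 1`, `0 < L ≤ 1`, `ν ≥ 0`, off the lattice,
  `G′(log D) ≥ 6κ ≥ 0 ≥ G″(log D)`:  `𝒜G(log D) + κ(L/π)𝒜S ≤ −(G′/2)·b sinh b/D − (κ/2)E`;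
* `rowOperator_lyapunovLayer_le'`: `… ≤ −(κ/4)(b² + 2(1 + cos a))` — strictly negative off the
  saddle set `{b = 0, a ≡ π (2π)}`, quadratic in the scaled distance to it;
* `stub_braidExit_cellLayer`: the registered def-free form;
* the real-variable lemma `cellLayer_ineq` and the elementary bounds `cosh_one_le : cosh 1 ≤ 31/20`,
  `cosh_sub_one_le_half_mul_sinh : cosh t − 1 ≤ t sinh t/2`, `mul_sinh_nonneg'`.

The operator of the sum is written as the SUM of the two operators (slice derivatives are additive for
the `C²` functions at hand; the assembler adds that one line), so no additivity lemma for
`StretchedLayer.lap` is needed here. Consequence (design note, cf. part B's account of the missing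
saddle layer): with `G(s) = AΛ log(1 + (s − s₀)/Λ)` (`G′ ∈ [A/2, A]` on the cells) and `κ = A/12`, the
function `Ψ = G(log D) + κ(L/π)η(b)S` has `𝒜(MΨ) ≤ −1` on `{|b| ≤ 1} ∖ {b² + 2(1 + cos a) < 48/(MA)}`,
and by part A/B on `{|b| ≥ 1}` (cutoff junk of `η` is `O(A)`, absorbed by `−G′ b tanh(b/2)` for `A`
large); what remains is exactly a neighbourhood of the saddles. -/

-- `Summit.<Summit>.<Problem>` is the mandated summit-side namespace (CONVENTIONS §2): duplicate deliberate.
set_option linter.dupNamespace false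

noncomputable section

open scoped Topology
open Filter Set

namespace Summit.AnomalousDissipation.AnomalousDissipation.Theorems.MarginalStabilityChainStretchedVortexRows.BraidExit

open Literature.Analysis.FluidPDE Literature.Analysis.FluidPDE.StretchedLayer

variable {L : ℝ}


/-- `cosh 1 ≤ 31/20` (from `e < 2.7182818286`, `e > 2.7`). [folklore] -/
theorem cosh_one_le : Real.cosh 1 ≤ 31 / 20 := by
  rw [Real.cosh_eq]
  have h1 : Real.exp 1 ≤ 2.7182818286 := Real.exp_one_lt_d9.le
  have h2 : Real.exp (-1) ≤ (27 / 10)⁻¹ := by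
    rw [Real.exp_neg]
    exact inv_anti₀ (by norm_num) (by linarith [Real.exp_one_gt_d9])
  norm_num at h2
  linarith

/-- `cosh t − 1 ≤ t sinh t/2` (both sides even; `(t sinh t/2 − cosh t + 1)′ = (t cosh t − sinh t)/2 ≥ 0`
on `t ≥ 0` since `sinh t ≤ t cosh t`). [folklore] -/
theorem cosh_sub_one_le_half_mul_sinh (t : ℝ) : Real.cosh t - 1 ≤ t * Real.sinh t / 2 := by
  suffices key : ∀ u : ℝ, 0 ≤ u → Real.cosh u - 1 ≤ u * Real.sinh u / 2 by
    rcases le_total 0 t with ht | ht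
    · exact key t ht
    · have := key (-t) (neg_nonneg.2 ht)
      simpa [Real.cosh_neg, Real.sinh_neg] using this
  intro u hu
  have hmono : MonotoneOn (fun s : ℝ => s * Real.sinh s / 2 - (Real.cosh s - 1)) (Ici 0) := by
    refine monotoneOn_of_deriv_nonneg (convex_Ici 0) (by fun_prop) (by fun_prop) fun s hs => ?_
    rw [interior_Ici] at hs
    have hd : HasDerivAt (fun s : ℝ => s * Real.sinh s / 2 - (Real.cosh s - 1))
        ((1 * Real.sinh s + s * Real.cosh s) / 2 - Real.sinh s) s := by
      have h1 := ((hasDerivAt_id s).mul (Real.hasDerivAt_sinh s)).div_const 2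
      have h2 := (Real.hasDerivAt_cosh s).sub_const 1
      exact (h1.sub h2).congr_deriv (by simp)
    rw [hd.deriv]
    -- `sinh s ≤ s cosh s` for `s ≥ 0`
    have hs' : Real.sinh s ≤ s * Real.cosh s := by
      have hmono2 : MonotoneOn (fun s : ℝ => s * Real.cosh s - Real.sinh s) (Ici 0) := by
        refine monotoneOn_of_deriv_nonneg (convex_Ici 0) (by fun_prop) (by fun_prop) fun w hw => ?_
        rw [interior_Ici] at hw
        have hd2 : HasDerivAt (fun s : ℝ => s * Real.cosh s - Real.sinh s)
            (1 * Real.cosh w + w * Real.sinh w - Real.cosh w) w :=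
          ((hasDerivAt_id w).mul (Real.hasDerivAt_cosh w)).sub (Real.hasDerivAt_sinh w)
        rw [hd2.deriv]
        have hw' : 0 < w := hw
        have := Real.sinh_nonneg_iff.2 hw'.le
        nlinarith [mul_nonneg hw'.le this]
      have := hmono2 (self_mem_Ici) (le_of_lt hs : (0:ℝ) ≤ s) (le_of_lt hs)
      simpa using this
    nlinarith
  have := hmono (self_mem_Ici) hu hu
  simp at this
  linarith

/-- The real-variable inequality behind the cell layer: with `A = cos a`, `Sa = sin a`, `B = cosh b`,
`Sb = sinh b`, `E = (B − 1) + (1 + A)`, `D > 0`, `|b| ≤ 1` encoded as `B ≤ 31/20 (≥ cosh 1)`,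
`b²/2 ≤ B − 1 ≤ b Sb/2`, `L ≤ 1 < π/3.14…`, and `G₁ ≥ 6κ ≥ 0 ≥ G₂`:
the positive part `κE(B − 1)(1 + A)/D ≤ 2.55κ · bSb/D ≤ (G₁/2)·bSb/D` of the corrector's transport is
paid by half of the radial layer's, and `κ(L/π)|b Sa|B ≤ (κ/2)(b² + Sa²)/2·(2·0.4936…) ≤ (κ/2)E` by half
of `−κE`. [folklore] -/
theorem cellLayer_ineq {κ G₁ G₂ ν c L D E A B Sa Sb b : ℝ}
    (hκ : 0 ≤ κ) (hG₁ : 6 * κ ≤ G₁) (hG₂ : G₂ ≤ 0) (hν : 0 ≤ ν) (hL : 0 < L) (hL1 : L ≤ 1)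
    (hD : 0 < D) (hE : 0 ≤ E) (hEdef : E = (B - 1) + (1 + A)) (hA : -1 ≤ A) (hA1 : A ≤ 1)
    (hSa : Sa ^ 2 + A ^ 2 = 1) (hB : 1 ≤ B) (hB1 : B ≤ 31 / 20) (hb2 : b ^ 2 / 2 ≤ B - 1)
    (hβ : 0 ≤ b * Sb) (hB2 : B - 1 ≤ b * Sb / 2) :
    ν * c ^ 2 * (E / D) * G₂ - G₁ * (b * Sb / D) +
        κ * (L / Real.pi) * (Real.pi / L * (-(E * D) + E * ((B - 1) * (1 + A))) / D - b * Sa * B) ≤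
      -(G₁ / 2) * (b * Sb / D) - κ / 2 * E := by
  have hπ : 0 < Real.pi := Real.pi_pos
  have hπ3 : 3.14 < Real.pi := Real.pi_gt_d2
  -- the diffusion term
  have h0 : ν * c ^ 2 * (E / D) * G₂ ≤ 0 :=
    mul_nonpos_of_nonneg_of_nonpos (by positivity) hG₂
  -- reshape the corrector term
  have hresh : κ * (L / Real.pi) * (Real.pi / L * (-(E * D) + E * ((B - 1) * (1 + A))) / D - b * Sa * B) =
      -(κ * E) + κ * (E * ((B - 1) * (1 + A)) / D) - κ * (L / Real.pi) * (b * Sa * B) := by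
    field_simp
  rw [hresh]
  -- P₁
  have hP1a : E * ((B - 1) * (1 + A)) ≤ 51 / 20 * (b * Sb) := by
    have h1 : (B - 1) * (1 + A) ≤ (b * Sb / 2) * 2 :=
      mul_le_mul hB2 (by linarith) (by linarith) (by linarith)
    have h2 : E ≤ 51 / 20 := by rw [hEdef]; linarith
    calc E * ((B - 1) * (1 + A)) ≤ E * (b * Sb / 2 * 2) := mul_le_mul_of_nonneg_left h1 hE
      _ = E * (b * Sb) := by ring
      _ ≤ 51 / 20 * (b * Sb) := mul_le_mul_of_nonneg_right h2 hβ
  have hP1 : κ * (E * ((B - 1) * (1 + A)) / D) ≤ G₁ / 2 * (b * Sb / D) := by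
    rw [mul_div_assoc']
    rw [div_le_iff₀ hD]
    have : G₁ / 2 * (b * Sb / D) * D = G₁ / 2 * (b * Sb) := by field_simp
    rw [this]
    nlinarith [mul_le_mul_of_nonneg_left hP1a hκ]
  -- P₂
  have hP2 : -(κ * (L / Real.pi) * (b * Sa * B)) ≤ κ / 2 * E := by
    have h1 : |b * Sa| ≤ (b ^ 2 + Sa ^ 2) / 2 := by
      rw [abs_le]; constructor <;> nlinarith [sq_nonneg (b + Sa), sq_nonneg (b - Sa)]
    have h2 : Sa ^ 2 ≤ 2 * (1 + A) := by nlinarith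
    have h3 : (b ^ 2 + Sa ^ 2) / 2 ≤ E := by rw [hEdef]; linarith
    have h4 : L / Real.pi * B ≤ 1 / 2 := by
      have : L / Real.pi ≤ 100 / 314 := by rw [div_le_iff₀ hπ]; linarith
      have hB0 : 0 ≤ B := by linarith
      calc L / Real.pi * B ≤ 100 / 314 * (31 / 20) := mul_le_mul this hB1 hB0 (by norm_num)
        _ ≤ 1 / 2 := by norm_num
    have h5 : -(κ * (L / Real.pi) * (b * Sa * B)) ≤ κ * (L / Real.pi * B) * |b * Sa| := by
      have : -(κ * (L / Real.pi) * (b * Sa * B)) = κ * (L / Real.pi * B) * (-(b * Sa)) := by ring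
      rw [this]
      exact mul_le_mul_of_nonneg_left (neg_le_abs _) (by positivity)
    have h6 : κ * (L / Real.pi * B) * |b * Sa| ≤ κ * (1 / 2) * E := by
      have := mul_le_mul h4 (h1.trans h3) (abs_nonneg _) (by norm_num)
      calc κ * (L / Real.pi * B) * |b * Sa| = κ * ((L / Real.pi * B) * |b * Sa|) := by ring
        _ ≤ κ * ((1 / 2) * E) := mul_le_mul_of_nonneg_left this hκ
        _ = κ * (1 / 2) * E := by ring
    linarith
  nlinarith

/-- `0 ≤ b sinh b` for `b = 2πy/L`, `L > 0`. [folklore] -/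
theorem mul_sinh_nonneg' (hL : 0 < L) (y : ℝ) :
    0 ≤ 2 * Real.pi * y / L * Real.sinh (2 * Real.pi * y / L) := by
  have : 2 * Real.pi * y / L * Real.sinh (2 * Real.pi * y / L) =
      2 * Real.pi / L * (y * Real.sinh (2 * Real.pi * y / L)) := by ring
  rw [this]
  exact mul_nonneg (by positivity) (mul_sinh_nonneg hL y)

/-- **The cell layer** (`|b| ≤ 1`, i.e. `|y| ≤ L/2π`; every `x`; off the lattice): for the global
Lyapunov combination `Ψ = G(log D) + κ(L/π)·S` with `G′(log D) ≥ 6κ ≥ 0`, `G″(log D) ≤ 0`, `0 < L ≤ 1`,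
`ν ≥ 0`, the stub's operator (written as the sum of the two operators of parts A and B) satisfies
`𝒜G(log D) + κ(L/π)𝒜S ≤ −(G′/2)·b sinh b/D − (κ/2)·E`, `E = cosh b + cos a`: nonpositive, and zero only
at the saddles `b = 0`, `a ≡ π` — the far field, the cells AND the cores (where `b sinh b/D ≈ 2 sin²θ`,
`E ≈ 2`) need nothing else. [folklore] -/
theorem rowOperator_lyapunovLayer_le {U : Set ℝ} (hU : IsOpen U) {G G' G'' : ℝ → ℝ}
    (hG : ∀ s ∈ U, HasDerivAt G (G' s) s) (hG' : ∀ s ∈ U, HasDerivAt G' (G'' s) s)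
    {ν : ℝ} (hν : 0 ≤ ν) (hL : 0 < L) (hL1 : L ≤ 1) {κ : ℝ} (hκ : 0 ≤ κ) {x y : ℝ}
    (hD : 0 < rowD L x y) (hU' : Real.log (rowD L x y) ∈ U) (hb : |2 * Real.pi * y / L| ≤ 1)
    (hG₁ : 6 * κ ≤ G' (Real.log (rowD L x y))) (hG₂ : G'' (Real.log (rowD L x y)) ≤ 0) :
    (ν * lap (radialLayer L G) x y +
        Real.sinh (2 * Real.pi * y / L) /
            (2 * (Real.cosh (2 * Real.pi * y / L) - Real.cos (2 * Real.pi * x / L))) *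
          dX (radialLayer L G) x y +
        (-(Real.sin (2 * Real.pi * x / L) /
            (2 * (Real.cosh (2 * Real.pi * y / L) - Real.cos (2 * Real.pi * x / L)))) - y) *
          dY (radialLayer L G) x y) +
      κ * (L / Real.pi) * (ν * lap (rowS L) x y +
        Real.sinh (2 * Real.pi * y / L) /
            (2 * (Real.cosh (2 * Real.pi * y / L) - Real.cos (2 * Real.pi * x / L))) *
          dX (rowS L) x y +
        (-(Real.sin (2 * Real.pi * x / L) /
            (2 * (Real.cosh (2 * Real.pi * y / L) - Real.cos (2 * Real.pi * x / L)))) - y) *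
          dY (rowS L) x y) ≤
      -(G' (Real.log (rowD L x y)) / 2) *
          (2 * Real.pi * y / L * Real.sinh (2 * Real.pi * y / L) / rowD L x y) -
        κ / 2 * rowE L x y := by
  rw [rowOperator_radialLayer hU hG hG' ν hD hU', rowOperator_rowS ν L x y, cos_mul_sinh_sq_sub,
    rowE_mul_sub_one]
  have hDdef : Real.cosh (2 * Real.pi * y / L) - Real.cos (2 * Real.pi * x / L) = rowD L x y := rfl
  have hEdef : Real.cosh (2 * Real.pi * y / L) + Real.cos (2 * Real.pi * x / L) = rowE L x y := rfl
  rw [hDdef, hEdef]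
  have hB1 : Real.cosh (2 * Real.pi * y / L) ≤ 31 / 20 := by
    have : Real.cosh (2 * Real.pi * y / L) ≤ Real.cosh 1 := by
      rw [Real.cosh_le_cosh]; simpa using hb
    exact this.trans cosh_one_le
  exact cellLayer_ineq hκ hG₁ hG₂ hν hL hL1 hD (rowE_nonneg L x y) (by unfold rowE; ring)
    (Real.neg_one_le_cos _) (Real.cos_le_one _) (Real.sin_sq_add_cos_sq _) (Real.one_le_cosh _) hB1
    (sq_div_two_le_cosh_sub_one _) (mul_sinh_nonneg' hL y) (cosh_sub_one_le_half_mul_sinh _)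

/-- **Cell layer, distance-to-saddle form**: under the same hypotheses the operator sum is
`≤ −(κ/4)(b² + 2(1 + cos a))` — strictly negative off the saddle set `{b = 0, cos a = −1}`, with the
explicit quadratic rate in the (scaled) distance to it (`1 + cos a = 2 sin²((a − π)/2)`). [folklore] -/
theorem rowOperator_lyapunovLayer_le' {U : Set ℝ} (hU : IsOpen U) {G G' G'' : ℝ → ℝ}
    (hG : ∀ s ∈ U, HasDerivAt G (G' s) s) (hG' : ∀ s ∈ U, HasDerivAt G' (G'' s) s)
    {ν : ℝ} (hν : 0 ≤ ν) (hL : 0 < L) (hL1 : L ≤ 1) {κ : ℝ} (hκ : 0 ≤ κ) {x y : ℝ}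
    (hD : 0 < rowD L x y) (hU' : Real.log (rowD L x y) ∈ U) (hb : |2 * Real.pi * y / L| ≤ 1)
    (hG₁ : 6 * κ ≤ G' (Real.log (rowD L x y))) (hG₂ : G'' (Real.log (rowD L x y)) ≤ 0) :
    (ν * lap (radialLayer L G) x y +
        Real.sinh (2 * Real.pi * y / L) /
            (2 * (Real.cosh (2 * Real.pi * y / L) - Real.cos (2 * Real.pi * x / L))) *
          dX (radialLayer L G) x y +
        (-(Real.sin (2 * Real.pi * x / L) /
            (2 * (Real.cosh (2 * Real.pi * y / L) - Real.cos (2 * Real.pi * x / L)))) - y) *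
          dY (radialLayer L G) x y) +
      κ * (L / Real.pi) * (ν * lap (rowS L) x y +
        Real.sinh (2 * Real.pi * y / L) /
            (2 * (Real.cosh (2 * Real.pi * y / L) - Real.cos (2 * Real.pi * x / L))) *
          dX (rowS L) x y +
        (-(Real.sin (2 * Real.pi * x / L) /
            (2 * (Real.cosh (2 * Real.pi * y / L) - Real.cos (2 * Real.pi * x / L)))) - y) *
          dY (rowS L) x y) ≤
      -(κ / 4) * ((2 * Real.pi * y / L) ^ 2 + 2 * (1 + Real.cos (2 * Real.pi * x / L))) := by
  refine (rowOperator_lyapunovLayer_le hU hG hG' hν hL hL1 hκ hD hU' hb hG₁ hG₂).trans ?_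
  have h1 : 0 ≤ G' (Real.log (rowD L x y)) / 2 *
      (2 * Real.pi * y / L * Real.sinh (2 * Real.pi * y / L) / rowD L x y) :=
    mul_nonneg (by linarith) (div_nonneg (mul_sinh_nonneg' hL y) hD.le)
  have h2 := sq_div_two_le_cosh_sub_one (2 * Real.pi * y / L)
  unfold rowE
  nlinarith

/-- **Registered sub-goal `stub_braidExit_cellLayer`** (def-free form of
`rowOperator_lyapunovLayer_le'`): in the strip `|2πy/L| ≤ 1`, off the lattice, the stub's operator on
`G(log D)` plus `κ(L/π)` times the operator on `sin a sinh b` is `≤ −(κ/4)((2πy/L)² + 2(1 + cos a))`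
whenever `G′(log D) ≥ 6κ ≥ 0 ≥ G″(log D)`, `0 < L ≤ 1`, `ν ≥ 0`. [folklore] -/
theorem stub_braidExit_cellLayer : ∀ (L ν κ : ℝ) (U : Set ℝ) (G G' G'' : ℝ → ℝ), 0 < L → L ≤ 1 → 0 ≤ ν → 0 ≤ κ → IsOpen U → (∀ s ∈ U, HasDerivAt G (G' s) s) → (∀ s ∈ U, HasDerivAt G' (G'' s) s) → ∀ x y : ℝ, 0 < Real.cosh (2 * Real.pi * y / L) - Real.cos (2 * Real.pi * x / L) → Real.log (Real.cosh (2 * Real.pi * y / L) - Real.cos (2 * Real.pi * x / L)) ∈ U → |2 * Real.pi * y / L| ≤ 1 → 6 * κ ≤ G' (Real.log (Real.cosh (2 * Real.pi * y / L) - Real.cos (2 * Real.pi * x / L))) → G'' (Real.log (Real.cosh (2 * Real.pi * y / L) - Real.cos (2 * Real.pi * x / L))) ≤ 0 → (ν * lap (fun x y => G (Real.log (Real.cosh (2 * Real.pi * y / L) - Real.cos (2 * Real.pi * x / L)))) x y + Real.sinh (2 * Real.pi * y / L) / (2 * (Real.cosh (2 * Real.pi * y / L) - Real.cos (2 * Real.pi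 * x / L))) * dX (fun x y => G (Real.log (Real.cosh (2 * Real.pi * y / L) - Real.cos (2 * Real.pi * x / L)))) x y + (-(Real.sin (2 * Real.pi * x / L) / (2 * (Real.cosh (2 * Real.pi * y / L) - Real.cos (2 * Real.pi * x / L)))) - y) * dY (fun x y => G (Real.log (Real.cosh (2 * Real.pi * y / L) - Real.cos (2 * Real.pi * x / L)))) x y) + κ * (L / Real.pi) * (ν * lap (fun x y => Real.sin (2 * Real.pi * x / L) * Real.sinh (2 * Real.pi * y / L)) x y + Real.sinh (2 * Real.pi * y / L) / (2 * (Real.cosh (2 * Real.pi * y / L) - Real.cos (2 * Real.pi * x / L))) * dX (fun x y => Real.sin (2 * Real.pi * x / L) * Real.sinh (2 * Real.pi * y / L)) x y + (-(Real.sin (2 * Real.pi * x / L) / (2 * (Real.cosh (2 * Real.pi * y / L) - Real.cos (2 * Real.pi * x / L)))) - y) * dY (fun x y => Real.sin (2 * Real.pi * x / L) * Real.sinh (2 * Real.pi * y / L)) x y) ≤ -(κ / 4) * ((2 * Real.pi * y / L) ^ 2 + 2 * (1 + Real.cos (2 * Real.pi * x / L))) := by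
  intro L ν κ U G G' G'' hL hL1 hν hκ hU hG hG' x y hD hU' hb hG₁ hG₂
  exact rowOperator_lyapunovLayer_le' hU hG hG' hν hL hL1 hκ hD hU' hb hG₁ hG₂

end Summit.AnomalousDissipation.AnomalousDissipation.Theorems.MarginalStabilityChainStretchedVortexRows.BraidExit

end
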